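import Mathlib
import Summits.KontsevichZagierPeriods.Zeta5Search.TopFamilyFPCellsA
import Summits.KontsevichZagierPeriods.Zeta5Search.TopFamilyFPCellsB
import Summits.KontsevichZagierPeriods.Zeta5Search.TopFamilyFPCellsC
import Summits.KontsevichZagierPeriods.Zeta5Search.TopFamilyFPCellsD
import Summits.KontsevichZagierPeriods.Zeta5Search.TopFamilyFPCellsE
import Summits.KontsevichZagierPeriods.Zeta5Search.TopFamilyFPCellsF
import Summits.KontsevichZagierPeriods.Zeta5Search.TopFamilyFPCellsG
import Summits.KontsevichZagierPeriods.Zeta5Search.TopFamilyFPCellsH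
import Summits.KontsevichZagierPeriods.Zeta5Search.TS3RayCellsD
import Summits.KontsevichZagierPeriods.Zeta5Search.TS3RayCellsG
import Summits.KontsevichZagierPeriods.Zeta5Search.TS3RayCellsH
import Summits.KontsevichZagierPeriods.Zeta5Search.TS3RayCellsI
import Summits.KontsevichZagierPeriods.Zeta5Search.TS3RayCellsM
import Summits.KontsevichZagierPeriods.Zeta5Search.TS1RayDominance
import HarnessLib

/-!
# ζ(5) search — the Casoratian class bound and the three bonus rungs on the θ-cells `(t+1)n < p ≤ (t+11)n` of the TOP linear family, ALL `t ≥ 4`, ALL `n`, every direction `j`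

Cell `pub-zeta5` (HONEST FRAMING: systematic search; no irrationality claim unless certified), TRACK «DENOM-LAW» D1 prover seat
(denom-prover-d1 g16, `HOME/denom-law/prover-d1/ATTEMPT-16.md`).  The TOP linear family `bTop t n = bLin (t n + 2n) (t n) n = n·(3t+16; t+8, …, t+2)`
(`b₀ = (3t+16)n`, `d = (2t+13)n`, pair blocks `(t+1)n, …, (t+11)n`; census TOP_STAIR #1 = `t = 6`, TOP_STAIR #9 = `t = 7`) — a TWO-parameter family of
dual rays.  From the machine-generated class-type covers `TopFamilyFPCellsA–H` (valid for every `t ≥ 4`, `n ≥ 1`): §0 the ray kit for EVERY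
contiguity index `j` (parameter values, shifts in the polytope, window facts for `p > (t+1)n`, THEOREM LB `cas_ge_casLB`, the parity flag of `b₀`);
§1 the value of the tree's class bound cell by cell (six of the decidable checks are LITERALLY TOP_STAIR #3's — same type lists on `(33,35], (36,38], (38,40], (41,43]` and the odd-`n` `(85/3,30]` of `bRay ts3 n` — and are cited from `TS3RayCellsD/G/H/I/M`, gate dedup) — `casLB ≥ −13, −11, −9, −9, −7, −9, −7, −7, −5, −3, −1, 0` on
`(t+1,t+2], (t+2,t+3], (t+3,t+4], (t+4,t+5], (t+5,(3t+16)/3], ((3t+16)/3,t+6], (t+6,(2t+13)/2], ((2t+13)/2,t+7], (t+7,t+8], (t+8,t+9], (t+9,t+10], (t+10,t+11]`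
(`θ = p/n`; the first four with the first-period bound `2p > (t+11)n`, the first also with `3p > (2t+13)n`); §2 the three cells where Brown–Zudilin's
PATH-accounting value exceeds `casLB`, each by a LANDED generic rung read on the cover for any `j`: the LEMMA-D bonus (`ClassTypeGuards.lemmaD_of_cover`,
`m = −8`, one live deep type `[1,−6,−4,1]` up to reversal, the palindrome `[1,−5,−5,1]` being dropped) on `(t+1,t+2]` (`v ≥ −12 = casLB + 1`), the
DOUBLE DROP (`StairFLAG.cover_B_j`, `N = 6`) on `((3t+16)/3, t+6]` (`v ≥ −7 = casLB + 2`), and the COLLINEARITY RUNG (`StairTS1.cover_O_j`, `N = 5`, keys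
`[−1,−4]`, `[−2,−3]`, moment range `4p + 2 ≤ 2d + 3`) on `(t+6, (2t+13)/2]` (`v ≥ −6 = casLB + 1`) — for `t = 6` these are EXACTLY g13's TOP_STAIR #1 bonus
cells `34n < 3p ≤ 36n` and `12n < p < 12.5n` (`TS1RayDominance`), now for the whole family.  Consumed by `DenomLaw/TopFamilyFPPath` (PATH accounting on
`θ > t+1` for every `t ≥ 4`).  MODEL/structure-side integer bookkeeping on the cell's own class data; nothing about ζ(5); no γ; records in print UNMOVED.
-/

open Finset

namespace Summit.KontsevichZagierPeriods.Zeta5Search.TopFamFP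

open Summit.KontsevichZagierPeriods.Zeta5Search.ClusterValuation
open Summit.KontsevichZagierPeriods.Zeta5Search.CasoratianValuation (InPolytope shift casoratian pairFloors refund)
open Summit.KontsevichZagierPeriods.Zeta5Search.WedgeDictionary (dOf coeffV)
open Summit.KontsevichZagierPeriods.Zeta5Search.ClassTypeCover
open Summit.KontsevichZagierPeriods.Zeta5Search.CellKit
open Summit.KontsevichZagierPeriods.Zeta5Search.TopFamCR (tf_zero dOf_tf inPolytope_tf)
open Summit.KontsevichZagierPeriods.Zeta5Search.StairFLAG (casLB_of_cover' cover_B_j)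
open Summit.KontsevichZagierPeriods.Zeta5Search.StairTS1 (cover_O_j)

/-! ## §0 Ray kit (every `j`) -/

/-- `b₁ = (t+8)n`. -/
theorem w1 (t n : ℕ) : bLin (t * n + 2 * n) (t * n) n 1 = ((t * n + 8 * n : ℕ) : ℤ) := by
  rw [bLin_succ _ _ _ 0 (by norm_num)]; congr 1; omega
/-- `b₂ = (t+7)n`. -/
theorem w2 (t n : ℕ) : bLin (t * n + 2 * n) (t * n) n 2 = ((t * n + 7 * n : ℕ) : ℤ) := by
  rw [bLin_succ _ _ _ 1 (by norm_num)]; congr 1; omega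
/-- `b₃ = (t+6)n`. -/
theorem w3 (t n : ℕ) : bLin (t * n + 2 * n) (t * n) n 3 = ((t * n + 6 * n : ℕ) : ℤ) := by
  rw [bLin_succ _ _ _ 2 (by norm_num)]; congr 1; omega
/-- `b₄ = (t+5)n`. -/
theorem w4 (t n : ℕ) : bLin (t * n + 2 * n) (t * n) n 4 = ((t * n + 5 * n : ℕ) : ℤ) := by
  rw [bLin_succ _ _ _ 3 (by norm_num)]; congr 1; omega
/-- `b₅ = (t+4)n`. -/
theorem w5 (t n : ℕ) : bLin (t * n + 2 * n) (t * n) n 5 = ((t * n + 4 * n : ℕ) : ℤ) := by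
  rw [bLin_succ _ _ _ 4 (by norm_num)]; congr 1; omega
/-- `b₆ = (t+3)n`. -/
theorem w6 (t n : ℕ) : bLin (t * n + 2 * n) (t * n) n 6 = ((t * n + 3 * n : ℕ) : ℤ) := by
  rw [bLin_succ _ _ _ 5 (by norm_num)]; congr 1; omega
/-- `b₇ = (t+2)n`. -/
theorem w7 (t n : ℕ) : bLin (t * n + 2 * n) (t * n) n 7 = ((t * n + 2 * n : ℕ) : ℤ) := by
  rw [bLin_succ _ _ _ 6 (by norm_num)]; congr 1; omega

/-- **Every contiguous shift `bTop t n + e_j` lies in the polytope** (`t ≥ 4`, `n ≥ 1`, `1 ≤ j ≤ 7`; `TopFamCR.inPolytope_shift_tf` is `j = 7`; `2(b₁+1) ≤ b₀` needs `tn ≥ 2`). -/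
theorem inPolytope_shift_tf_j {t n : ℕ} (ht : 4 * n ≤ t * n) (hn : 1 ≤ n) (j : ℕ) (hj1 : 1 ≤ j) (hj7 : j ≤ 7) :
    InPolytope (shift (bLin (t * n + 2 * n) (t * n) n) j) := by
  have hs : ∀ i, shift (bLin (t * n + 2 * n) (t * n) n) j i =
      if i = j then bLin (t * n + 2 * n) (t * n) n j + 1 else bLin (t * n + 2 * n) (t * n) n i := by
    intro i; simp only [shift, Function.update_apply]
  interval_cases j <;>
  · refine ⟨⟨?_, ?_⟩, ?_, ?_⟩
    · rw [hs]; simp only [Nat.reduceEqDiff, if_false, tf_zero]; positivity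
    · intro i hi
      simp only [Finset.mem_range] at hi
      interval_cases i <;> simp only [hs, Nat.reduceAdd, Nat.reduceEqDiff, if_true, if_false, tf_zero, w1, w2, w3, w4, w5, w6, w7] <;> omega
    · intro i hi
      simp only [Finset.mem_range] at hi
      interval_cases i <;> simp only [hs, Nat.reduceAdd, Nat.reduceEqDiff, if_true, if_false, tf_zero, w1, w2, w3, w4, w5, w6, w7] <;> omega
    · simp only [Finset.sum_range_succ, Finset.sum_range_zero, zero_add, Nat.reduceAdd, hs, Nat.reduceEqDiff, if_true, if_false,
        tf_zero, w1, w2, w3, w4, w5, w6, w7]; omega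

/-- Window facts above the innermost block, `p > (t+1)n` (`t ≥ 4`, `n ≥ 1`): `5 ≤ p` and `b₀ + 2 < p²`. -/
theorem window_fp {t n p : ℕ} (ht : 4 * n ≤ t * n) (hn : 1 ≤ n) (hA : t * n + n < p) :
    5 ≤ p ∧ (bLin (t * n + 2 * n) (t * n) n 0 + 2 : ℤ) < (p : ℤ) ^ 2 := by
  refine ⟨by omega, ?_⟩
  rw [tf_zero]
  have h1 : ((t * n + n + 1 : ℕ) : ℤ) ≤ p := by exact_mod_cast (show t * n + n + 1 ≤ p by omega)
  have h2 : ((5 * n + 1 : ℕ) : ℤ) ≤ p := by exact_mod_cast (show 5 * n + 1 ≤ p by omega)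
  have hprod : ((t * n + n + 1 : ℕ) : ℤ) * ((5 * n + 1 : ℕ) : ℤ) ≤ (p : ℤ) * p :=
    mul_le_mul h1 h2 (by positivity) (by positivity)
  have key : ((3 * (t * n) + 16 * n : ℕ) : ℤ) + 2 < ((t * n + n + 1 : ℕ) : ℤ) * ((5 * n + 1 : ℕ) : ℤ) := by
    have h := (show 3 * (t * n) + 16 * n + 3 ≤ (t * n + n + 1) * (5 * n + 1) by nlinarith)
    exact_mod_cast (by omega : 3 * (t * n) + 16 * n + 2 < (t * n + n + 1) * (5 * n + 1))
  nlinarith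

/-- Every prime above the innermost block is odd. -/
theorem odd_of_prime_fp {t n p : ℕ} (hprime : p.Prime) (ht : 4 * n ≤ t * n) (hn : 1 ≤ n) (hA : t * n + n < p) : p % 2 = 1 :=
  Nat.odd_iff.1 (hprime.odd_of_ne_two (by omega))

/-- `p ≤ d = (2t+13)n`. -/
theorem le_dOf_tf {t n p : ℕ} (h : p ≤ 2 * (t * n) + 13 * n) : (p : ℤ) ≤ dOf (bLin (t * n + 2 * n) (t * n) n) := by
  rw [dOf_tf]; exact_mod_cast h

/-- `p ≤ b₀ = (3t+16)n`. -/
theorem le_b0_tf {t n p : ℕ} (h : p ≤ 3 * (t * n) + 16 * n) : (p : ℤ) ≤ bLin (t * n + 2 * n) (t * n) n 0 := by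
  rw [tf_zero]; exact_mod_cast h

/-- **THEOREM LB on the family, any direction `j`**: `casLB(bTop t n, p) ≤ v_p(Cas_j(bTop t n))` for `p > (t+1)n` (`t ≥ 4`). -/
theorem cas_ge_casLB {t n j p : ℕ} (ht : 4 * n ≤ t * n) (hn : 1 ≤ n) (hj1 : 1 ≤ j) (hj7 : j ≤ 7) (hprime : p.Prime) (hA : t * n + n < p)
    (hcas : casoratian (bLin (t * n + 2 * n) (t * n) n) j ≠ 0) :
    casLB (bLin (t * n + 2 * n) (t * n) n) p ≤ padicValRat p (casoratian (bLin (t * n + 2 * n) (t * n) n) j) := by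
  obtain ⟨hp5, hwin⟩ := window_fp ht hn hA
  exact casoratianClassBound_holds _ j p (inPolytope_tf t n) hj1 hj7 (inPolytope_shift_tf_j ht hn j hj1 hj7) hprime hp5 hwin hcas

/-- The parity flag of `b₀ = (3t+16)n` for even `tn`. -/
theorem oddFlag_even {t n : ℕ} (h : (t * n) % 2 = 0) : decide (¬ (2 : ℤ) ∣ bLin (t * n + 2 * n) (t * n) n 0) = false := by
  rw [tf_zero, decide_eq_false_iff_not, not_not]
  exact ⟨((3 * (t * n) + 16 * n) / 2 : ℕ), by push_cast; omega⟩

/-- The parity flag of `b₀ = (3t+16)n` for odd `tn`. -/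
theorem oddFlag_odd {t n : ℕ} (h : (t * n) % 2 = 1) : decide (¬ (2 : ℤ) ∣ bLin (t * n + 2 * n) (t * n) n 0) = true := by
  rw [tf_zero, decide_eq_true_iff]
  intro hd
  omega

/-! ## §1 `casLB` cell by cell (from the covers; `d = (2t+13)n ≥ p` on all these cells) -/

section Cells
variable {t n p : ℕ} [Fact p.Prime]

/-- `(t+1, t+2]` (first period, `3p > (2t+13)n`): `casLB ≥ −13` (parity-split covers). -/
theorem casLB_c1 (ht : 4 * n ≤ t * n) (hn : 1 ≤ n) (hA : t * n + n < p) (hB : p ≤ t * n + 2 * n) (hD : 2 * (t * n) + 13 * n < 3 * p)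
    (hF : t * n + 11 * n < 2 * p) (hp2 : p % 2 = 1) : (-13 : ℤ) ≤ casLB (bLin (t * n + 2 * n) (t * n) n) p := by
  rcases Nat.mod_two_eq_zero_or_one (t * n) with hr | hr
  · rcases casLB_of_cover' (cover_c1_ev ht hn hA hB hD hF hp2 hr) (by rw [oddFlag_even hr]; exact checkM_c1_ev) (by norm_num)
      (fun _ => by norm_num) with ⟨h0, -⟩ | h
    · rw [h0]; norm_num
    · linarith
  · have hno : n % 2 = 1 := Nat.odd_iff.mp (Nat.odd_mul.mp (Nat.odd_iff.mpr hr)).2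
    rcases casLB_of_cover' (cover_c1_od ht hn hA hB hD hF hp2 hr hno) (by rw [oddFlag_odd hr]; exact checkM_c1_od) (by norm_num)
      (fun _ => by norm_num) with ⟨h0, -⟩ | h
    · rw [h0]; norm_num
    · linarith

/-- `(t+2, t+3]` (first period): `casLB ≥ −11`. -/
theorem casLB_c2 (ht : 4 * n ≤ t * n) (hn : 1 ≤ n) (hA : t * n + 2 * n < p) (hB : p ≤ t * n + 3 * n) (hF : t * n + 11 * n < 2 * p)
    (hp2 : p % 2 = 1) : (-11 : ℤ) ≤ casLB (bLin (t * n + 2 * n) (t * n) n) p := by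
  rcases casLB_of_cover' (cover_c2 ht hn hA hB hF hp2) (checkM_c2 _) (by norm_num) (fun _ => by norm_num) with ⟨h0, -⟩ | h
  · rw [h0]; norm_num
  · linarith

/-- `(t+3, t+4]` (first period): `casLB ≥ −9`. -/
theorem casLB_c3 (ht : 4 * n ≤ t * n) (hn : 1 ≤ n) (hA : t * n + 3 * n < p) (hB : p ≤ t * n + 4 * n) (hF : t * n + 11 * n < 2 * p)
    (hp2 : p % 2 = 1) : (-9 : ℤ) ≤ casLB (bLin (t * n + 2 * n) (t * n) n) p := by
  rcases casLB_of_cover' (cover_c3 ht hn hA hB hF hp2) (checkM_c3 _) (by norm_num) (fun _ => by norm_num) with ⟨h0, -⟩ | h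
  · rw [h0]; norm_num
  · linarith

/-- `(t+4, t+5]` (first period): `casLB ≥ −9`. -/
theorem casLB_c4 (ht : 4 * n ≤ t * n) (hn : 1 ≤ n) (hA : t * n + 4 * n < p) (hB : p ≤ t * n + 5 * n) (hF : t * n + 11 * n < 2 * p)
    (hp2 : p % 2 = 1) : (-9 : ℤ) ≤ casLB (bLin (t * n + 2 * n) (t * n) n) p := by
  rcases casLB_of_cover' (cover_c4 ht hn hA hB hF hp2) (checkM_c4 _) (by norm_num) (fun _ => by norm_num) with ⟨h0, -⟩ | h
  · rw [h0]; norm_num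
  · linarith

/-- `(t+5, (3t+16)/3]`: `casLB ≥ −7`. -/
theorem casLB_c5a (ht : 4 * n ≤ t * n) (hn : 1 ≤ n) (hA : t * n + 5 * n < p) (hB : 3 * p ≤ 3 * (t * n) + 16 * n)
    (hp2 : p % 2 = 1) : (-7 : ℤ) ≤ casLB (bLin (t * n + 2 * n) (t * n) n) p := by
  rcases casLB_of_cover' (cover_c5a ht hn hA hB hp2) (checkM_c5a _) (by norm_num) (fun _ => by norm_num) with ⟨h0, -⟩ | h
  · rw [h0]; norm_num
  · linarith

/-- `((3t+16)/3, t+6]`: `casLB ≥ −9` (parity-split covers; the PATH value `−7` needs the double drop, §2). -/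
theorem casLB_c5b (ht : 4 * n ≤ t * n) (hn : 1 ≤ n) (hA : 3 * (t * n) + 16 * n < 3 * p) (hB : p ≤ t * n + 6 * n)
    (hp2 : p % 2 = 1) : (-9 : ℤ) ≤ casLB (bLin (t * n + 2 * n) (t * n) n) p := by
  rcases Nat.mod_two_eq_zero_or_one (t * n) with hr | hr
  · rcases casLB_of_cover' (cover_c5b_ev ht hn hA hB hp2 hr) (by rw [oddFlag_even hr]; exact checkM_c5b_ev) (by norm_num)
      (fun _ => by norm_num) with ⟨h0, -⟩ | h
    · rw [h0]; norm_num
    · linarith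
  · have hno : n % 2 = 1 := Nat.odd_iff.mp (Nat.odd_mul.mp (Nat.odd_iff.mpr hr)).2
    rcases casLB_of_cover' (cover_c5b_od ht hn hA hB hp2 hr hno) (by rw [oddFlag_odd hr]; exact StairTS3.checkM_c28b_od) (by norm_num)
      (fun _ => by norm_num) with ⟨h0, -⟩ | h
    · rw [h0]; norm_num
    · linarith

/-- `(t+6, (2t+13)/2]`: `casLB ≥ −7` (the PATH value `−6` needs the collinearity rung, §2). -/
theorem casLB_c6a (ht : 4 * n ≤ t * n) (hn : 1 ≤ n) (hA : t * n + 6 * n < p) (hB : 2 * p ≤ 2 * (t * n) + 13 * n)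
    (hp2 : p % 2 = 1) : (-7 : ℤ) ≤ casLB (bLin (t * n + 2 * n) (t * n) n) p := by
  rcases casLB_of_cover' (cover_c6a ht hn hA hB hp2) (checkM_c6a _) (by norm_num) (fun _ => by norm_num) with ⟨h0, -⟩ | h
  · rw [h0]; norm_num
  · linarith

/-- `((2t+13)/2, t+7]`: `casLB ≥ −7`. -/
theorem casLB_c6b (ht : 4 * n ≤ t * n) (hn : 1 ≤ n) (hA : 2 * (t * n) + 13 * n < 2 * p) (hB : p ≤ t * n + 7 * n)
    (hp2 : p % 2 = 1) : (-7 : ℤ) ≤ casLB (bLin (t * n + 2 * n) (t * n) n) p := by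
  rcases casLB_of_cover' (cover_c6b ht hn hA hB hp2) (checkM_c6b _) (by norm_num) (fun _ => by norm_num) with ⟨h0, -⟩ | h
  · rw [h0]; norm_num
  · linarith

/-- `(t+7, t+8]`: `casLB ≥ −5`. -/
theorem casLB_c7 (ht : 4 * n ≤ t * n) (hn : 1 ≤ n) (hA : t * n + 7 * n < p) (hB : p ≤ t * n + 8 * n)
    (hp2 : p % 2 = 1) : (-5 : ℤ) ≤ casLB (bLin (t * n + 2 * n) (t * n) n) p := by
  rcases casLB_of_cover' (cover_c7 ht hn hA hB hp2) (StairTS3.checkM_c33 _) (by norm_num) (fun _ => by norm_num) with ⟨h0, -⟩ | h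
  · rw [h0]; norm_num
  · linarith

/-- `(t+8, t+9]` (the STAIR cell of `StairTopFamily`, here closed and for `t ≥ 4`): `casLB ≥ −3`. -/
theorem casLB_c8 (ht : 4 * n ≤ t * n) (hn : 1 ≤ n) (hA : t * n + 8 * n < p) (hB : p ≤ t * n + 9 * n)
    (hp2 : p % 2 = 1) : (-3 : ℤ) ≤ casLB (bLin (t * n + 2 * n) (t * n) n) p := by
  rcases casLB_of_cover' (cover_c8 ht hn hA hB hp2) (StairTS3.checkM_c36 _) (by norm_num) (fun _ => by norm_num) with ⟨h0, -⟩ | h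
  · rw [h0]; norm_num
  · linarith

/-- `(t+9, t+10]`: `casLB ≥ −1`. -/
theorem casLB_c9 (ht : 4 * n ≤ t * n) (hn : 1 ≤ n) (hA : t * n + 9 * n < p) (hB : p ≤ t * n + 10 * n)
    (hp2 : p % 2 = 1) : (-1 : ℤ) ≤ casLB (bLin (t * n + 2 * n) (t * n) n) p := by
  rcases casLB_of_cover' (cover_c9 ht hn hA hB hp2) (StairTS3.checkM_c38 _) (by norm_num)
    (fun h => absurd h (by rw [dOf_tf]; omega)) with ⟨h0, -⟩ | h
  · rw [h0]; norm_num
  · linarith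

/-- `(t+10, t+11]`: `casLB ≥ 0`. -/
theorem casLB_c10 (ht : 4 * n ≤ t * n) (hn : 1 ≤ n) (hA : t * n + 10 * n < p) (hB : p ≤ t * n + 11 * n)
    (hp2 : p % 2 = 1) : (0 : ℤ) ≤ casLB (bLin (t * n + 2 * n) (t * n) n) p := by
  rcases casLB_of_cover' (cover_c10 ht hn hA hB hp2) (StairTS3.checkM_c41 _) (by norm_num)
    (fun h => absurd h (by rw [dOf_tf]; omega)) with ⟨h0, -⟩ | h
  · rw [h0]
  · linarith

end Cells

/-! ## §2 The three bonus cells, any direction `j` -/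

/-- **The Lemma-D bonus for any direction `j`** (`ClassTypeGuards.lemmaD_of_cover` with its fallback; the ray files' `cover_J_ts3` for general `b`):
`c ≤ v_p(Cas_j(b))` from a cover, `checkLB` at `(m, B)` with `c ≤ m + B + 1`, `checkJ` at `m`, fallback `checkLBx` at `(m; A', B')` with `c ≤ A' + B'`. -/
theorem cover_J_j {b : ℕ → ℤ} {p j : ℕ} (hb : InPolytope b) (hj1 : 1 ≤ j) (hj7 : j ≤ 7) (hb' : InPolytope (shift b j)) (hpr : p.Prime)
    (hp5 : 5 ≤ p) (hpb : (p : ℤ) ≤ b 0) (hpd : (p : ℤ) ≤ dOf b) (hwin : (b 0 + 2 : ℤ) < (p : ℤ) ^ 2)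
    {TY : List (List ℤ × Bool)} (hcov : Cover b p TY) {m B A' B' c : ℤ}
    (hLB : checkLB (decide (¬ (2 : ℤ) ∣ b 0)) TY m B = true) (hB1 : B ≤ 1)
    (hJ : checkJ (decide (¬ (2 : ℤ) ∣ b 0)) TY m = true)
    (hLBx : checkLBx (decide (¬ (2 : ℤ) ∣ b 0)) TY m A' B' = true) (hB1' : B' ≤ 1)
    (hc : c ≤ m + B + 1) (hc' : c ≤ A' + B') (hc0 : c ≤ 0)
    (hne : casoratian b j ≠ 0) : c ≤ padicValRat p (casoratian b j) := by
  haveI : Fact p.Prime := ⟨hpr⟩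
  have hv := casoratianClassBound_holds b j p hb hj1 hj7 hb' hpr hp5 hwin hne
  by_cases hreal : ∃ x, x < p ∧ 2 ≤ classPoleCount b p x ∧ classExp b p x = m
  · have hJ' := lemmaD_of_cover hb hj1 hj7 hb' hpr hp5 hpb hpd hwin hcov hJ hreal hne
    rcases casLB_ge_of_cover hcov hLB hB1 hpd with h0 | h
    · rw [h0] at hv; exact le_trans (by exact_mod_cast hc0) hv
    · linarith
  · rcases casLB_ge_of_cover_x hcov hLBx hB1' hpd hreal with h0 | h
    · rw [h0] at hv; exact le_trans (by exact_mod_cast hc0) hv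
    · linarith

/-- **The Lemma-D cell `(t+1)n < p ≤ (t+2)n`** (first period, `3p > (2t+13)n`), any `j`, all `t ≥ 4`, `n ≥ 1`: `v_p(Cas_j(bTop t n)) ≥ −12 = casLB + 1`
(`m = −8`; parity-split covers `cover_c1_ev/od`). -/
theorem cas_ge_c1 {t n j p : ℕ} (ht : 4 * n ≤ t * n) (hn : 1 ≤ n) (hj1 : 1 ≤ j) (hj7 : j ≤ 7) (hprime : p.Prime)
    (hA : t * n + n < p) (hB : p ≤ t * n + 2 * n) (hD : 2 * (t * n) + 13 * n < 3 * p) (hF : t * n + 11 * n < 2 * p)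
    (hcas : casoratian (bLin (t * n + 2 * n) (t * n) n) j ≠ 0) :
    (-12 : ℤ) ≤ padicValRat p (casoratian (bLin (t * n + 2 * n) (t * n) n) j) := by
  haveI : Fact p.Prime := ⟨hprime⟩
  have hp2 : p % 2 = 1 := odd_of_prime_fp hprime ht hn hA
  obtain ⟨hp5, hwin⟩ := window_fp ht hn hA
  have hb := inPolytope_tf t n
  have hb' := inPolytope_shift_tf_j ht hn j hj1 hj7
  rcases Nat.mod_two_eq_zero_or_one (t * n) with hr | hr
  · obtain ⟨h1, h2, h3⟩ := checkJ_c1_ev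
    exact cover_J_j hb hj1 hj7 hb' hprime hp5 (le_b0_tf (by omega)) (le_dOf_tf (by omega)) hwin
      (cover_c1_ev ht hn hA hB hD hF hp2 hr)
      (by rw [oddFlag_even hr]; exact h1) (by norm_num) (by rw [oddFlag_even hr]; exact h2) (by rw [oddFlag_even hr]; exact h3)
      (by norm_num) (by norm_num) (by norm_num) (by norm_num) hcas
  · have hno : n % 2 = 1 := Nat.odd_iff.mp (Nat.odd_mul.mp (Nat.odd_iff.mpr hr)).2
    obtain ⟨h1, h2, h3⟩ := checkJ_c1_od
    exact cover_J_j hb hj1 hj7 hb' hprime hp5 (le_b0_tf (by omega)) (le_dOf_tf (by omega)) hwin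
      (cover_c1_od ht hn hA hB hD hF hp2 hr hno)
      (by rw [oddFlag_odd hr]; exact h1) (by norm_num) (by rw [oddFlag_odd hr]; exact h2) (by rw [oddFlag_odd hr]; exact h3)
      (by norm_num) (by norm_num) (by norm_num) (by norm_num) hcas

/-- **The double-drop cell `(3t+16)n < 3p ≤ 3(t+6)n`**, any `j`, all `t ≥ 4`, `n ≥ 1`: `v_p(Cas_j(bTop t n)) ≥ −7 = casLB + 2` (`N = 6`;
parity-split covers `cover_c5b_ev/od`; for `t = 6` this is TOP_STAIR #1's `34n < 3p ≤ 36n`). -/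
theorem cas_ge_c5b {t n j p : ℕ} (ht : 4 * n ≤ t * n) (hn : 1 ≤ n) (hj1 : 1 ≤ j) (hj7 : j ≤ 7) (hprime : p.Prime)
    (hA : 3 * (t * n) + 16 * n < 3 * p) (hB : p ≤ t * n + 6 * n)
    (hcas : casoratian (bLin (t * n + 2 * n) (t * n) n) j ≠ 0) :
    (-7 : ℤ) ≤ padicValRat p (casoratian (bLin (t * n + 2 * n) (t * n) n) j) := by
  haveI : Fact p.Prime := ⟨hprime⟩
  have hp2 : p % 2 = 1 := odd_of_prime_fp hprime ht hn (by omega)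
  obtain ⟨hp5, hwin⟩ := window_fp ht hn (show t * n + n < p by omega)
  have hb := inPolytope_tf t n
  have hb' := inPolytope_shift_tf_j ht hn j hj1 hj7
  rcases Nat.mod_two_eq_zero_or_one (t * n) with hr | hr
  · obtain ⟨h1, h2, h3⟩ := checkB_c5b_ev
    exact cover_B_j hb hj1 hj7 hb' hprime hp5 (le_b0_tf (by omega)) (le_dOf_tf (by omega)) hwin
      (cover_c5b_ev ht hn hA hB hp2 hr) (N := 6) (by norm_num) (by decide)
      (by rw [oddFlag_even hr]; exact h1) (by norm_num) (by rw [oddFlag_even hr]; exact h2) (by rw [oddFlag_even hr]; exact h3)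
      (by norm_num) (by norm_num) (by norm_num) (by norm_num) hcas
  · have hno : n % 2 = 1 := Nat.odd_iff.mp (Nat.odd_mul.mp (Nat.odd_iff.mpr hr)).2
    obtain ⟨h1, h2, h3⟩ := StairTS3.checkB_c28b_od
    exact cover_B_j hb hj1 hj7 hb' hprime hp5 (le_b0_tf (by omega)) (le_dOf_tf (by omega)) hwin
      (cover_c5b_od ht hn hA hB hp2 hr hno) (N := 6) (by norm_num) (by decide)
      (by rw [oddFlag_odd hr]; exact h1) (by norm_num) (by rw [oddFlag_odd hr]; exact h2) (by rw [oddFlag_odd hr]; exact h3)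
      (by norm_num) (by norm_num) (by norm_num) (by norm_num) hcas

/-- **The collinearity cell `(t+6)n < p`, `2p ≤ (2t+13)n`**, any `j`, all `t ≥ 4`, `n ≥ 1`: `v_p(Cas_j(bTop t n)) ≥ −6 = casLB + 1` (`N = 5`, keys
`[−1,−4]`, `[−2,−3]`; the moment range `4p + 2 ≤ 2d + 3 = (4t+26)n + 3` is the cell's upper bound; for `t = 6` this is TOP_STAIR #1's `12n < p < 12.5n`). -/
theorem cas_ge_c6a {t n j p : ℕ} (ht : 4 * n ≤ t * n) (hn : 1 ≤ n) (hj1 : 1 ≤ j) (hj7 : j ≤ 7) (hprime : p.Prime)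
    (hA : t * n + 6 * n < p) (hB : 2 * p ≤ 2 * (t * n) + 13 * n)
    (hcas : casoratian (bLin (t * n + 2 * n) (t * n) n) j ≠ 0) :
    (-6 : ℤ) ≤ padicValRat p (casoratian (bLin (t * n + 2 * n) (t * n) n) j) := by
  haveI : Fact p.Prime := ⟨hprime⟩
  have hp2 : p % 2 = 1 := odd_of_prime_fp hprime ht hn (by omega)
  obtain ⟨hp5, hwin⟩ := window_fp ht hn (show t * n + n < p by omega)
  obtain ⟨h1, h2, h3⟩ := checkO_c6a (decide (¬ (2 : ℤ) ∣ bLin (t * n + 2 * n) (t * n) n 0))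
  have hrange : ((5 : ℕ) - 1 : ℤ) * p + 2 ≤ 2 * dOf (bLin (t * n + 2 * n) (t * n) n) + 3 := by
    rw [dOf_tf]; push_cast
    have : (2 * p : ℤ) ≤ 2 * (t * n) + 13 * n := by exact_mod_cast hB
    linarith
  exact cover_O_j (inPolytope_tf t n) hj1 hj7 (inPolytope_shift_tf_j ht hn j hj1 hj7) hprime hp5 (le_b0_tf (by omega)) (le_dOf_tf (by omega)) hwin
    (cover_c6a ht hn hA hB hp2) (N := 5) (by norm_num) (by norm_num) hrange
    h1 (by norm_num) h2 h3 (by norm_num) (by norm_num) (by norm_num) (by norm_num) hcas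

end Summit.KontsevichZagierPeriods.Zeta5Search.TopFamFP
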